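import Summits.BirchSwinnertonDyer.BirchSwinnertonDyer.Theorems.GenusKolyvaginAtTwoGenusPrimitiveSupplyAtTwoPrimeHeegnerTwinPosDisc
import Summits.BirchSwinnertonDyer.BirchSwinnertonDyer.Theorems.GenusKolyvaginAtTwoGenusPrimitiveSupplyAtTwoConjugationTypeAtTwo
import Summits.BirchSwinnertonDyer.Rank1Residual.GaloisImage.CyclotomicLevelFrobenius
import Literature.NumberTheory.GaloisRepresentations.FrobeniusDensity
import Literature.NumberTheory.Automorphic.ChebotarevArtinRepHolds
import Literature.NumberTheory.EllipticCurves.HeegnerPointsKolyvaginLocalCriterion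
import Literature.NumberTheory.EllipticCurves.HeegnerPointsKolyvaginSquares
import Literature.NumberTheory.EllipticCurves.BSDSelmerSmithCasesProofs
import Literature.NumberTheory.EllipticCurves.TorsionFrobeniusProofs
import HarnessLib

/-!
# Route `GenusKolyvaginAtTwo`, crux `GenusPrimitiveSupplyAtTwo` (stmt-BirchSwinnertonDyer-22136):
# SILENT admissible primes exist (Čebotarev, proved) — the `Δ > 0` DEF = 1 supply with `K` free

Seat `bsd-line-gk2-p5` g7 (cell `bsd-f1-sign2`), SUPPLY lineage; second file of the g7 pair (first:
`…PrimeHeegnerTwinPosDisc.lean`, p611887). Summit-side THEOREM-ONLY file (no definition, no named fact, no `sorry`),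
`--supports stmt-BirchSwinnertonDyer-22136`. It discharges the one input that `…PosDisc` left displayed: the EXISTENCE,
beyond every bound, of SILENT admissible primes `ℓ ≡ 7 (mod 8)`, `ℓ ≡ −1 (mod p ∣ N_W odd)` (no root of the `2`-division
cubic mod `ℓ`, i.e. `a_ℓ` odd, i.e. `Frob_ℓ` of order `3` on `E[2]`) for `Δ_W > 0` and `ρ̄_{W,2}` onto — a NON-abelian
Čebotarev condition in `ℚ(E[2], ζ_{8N})`, compatible because `χ_Δ(−1) = +1` on `Δ > 0`.

PROOF (§2 `exists_silent_prime_gt`, axioms `propext, Classical.choice, Quot.sound`). Witness element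
`γ₀ = c₀ · [x, y] ∈ Γ_ℚ`: `c₀` a complex conjugation (`χ_m(c₀) = −1`, tree
`modNCyclotomicCharacter_of_isComplexConjugation`; `c₀` FIXES `E[2]` because `Δ > 0`, tree
`GenusKolySign.twoTorsion_smul_eq_of_Δ_pos`), and `[x, y]` a commutator with `ρ̄(x)` a transposition, `ρ̄(y)` a
`3`-cycle (§1, from `ρ̄_{W,2}` onto and `E[2] ≃ (ℤ/2)²`): `ρ̄([x,y])` is a `3`-cycle and `χ_m([x,y]) = 1` for the
mod-`m` cyclotomic character, `m = 8 N_W`. The set `{σ : σ = γ₀ on E[2], χ_m(σ) = χ_m(γ₀)}` is a neighbourhood of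
`γ₀` (`isOpen_torsionFixing`, `modNCyclotomicCharacter_eventually_eq_one`), so by the tree's PROVED Čebotarev
(`absoluteGaloisGroup.frobenius_dense` fed with `Automorphic.chebotarev_artinRep_holds`) it contains an arithmetic
Frobenius `γ` at a prime `𝔓 ∣ ℓ` with `ℓ` beyond any bound; `χ_m(Frob_ℓ) = ℓ` (tree
`CyclotomicLevel.Rat.modNCyclotomicCharacter_of_isArithFrobAtPlace`) gives `ℓ ≡ −1 (mod 8N)`; and `γ` moving every
non-zero point of `E[2]` gives, through the reduction Frobenius of `FrobShape.exists_frobenius_natCard_fixed_eq`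
(Silverman VII.3.1(b)), conjugation of primes above `ℓ` (`exists_smul_eq_of_mem_primesAbove_holds`) and the triviality
of inertia on `E[2]` (VII.4.1(a), `smul_geomTorsion_eq_of_mem_inertia`), that `Ẽ(𝔽_ℓ)[2] = 0`, i.e. `#Ẽ(𝔽_ℓ)` odd
(`natCard_point_reduction_minimal_baseChange`), i.e. `a_ℓ` odd, i.e. `ℓ` silent (`silent_iff_odd_frobeniusTrace`).

CONSEQUENCES (§3), for the pen's re-typing of 24947 / `MinimalTwinSupplyDEF1` on `Δ > 0`:
* `exists_silent_prime_heegnerField` (UNCONDITIONAL): DEF = 1 admissible Heegner fields `ℚ(√−ℓ)` with every K-clause of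
  crux 22136, `2` split, `E(ℚ_ℓ)[2] = 0`, `F1Sign2.DescAdmissible W (−ℓ)`, beyond every bound;
* `supply_DEF1_posDisc` (mod T-A `F1Sign2.AdmissibleTwistSelmerShiftAtTwo` ONLY): on `{Δ > 0, #Sel₂(W) = 1}` the whole
  SUPPLY″-Selmer — admissible DEF = 1 field + globally minimal twin with `#Sel₂ = 2`, `K` free beyond any bound (room for
  the certificate's Čebotarev side conditions) — exactly as g6 did on `Δ < 0` mod `prop33_rat`;
* `supply_DEF1_posDisc_rowOne_of_not_descentSignNeg` / `descentSignNeg_or_forall_minimalTwin` (mod T-V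
  `F1Sign2.StrictShaPropagationAtTwo`): on row 1 (`rank 0`, `#Sel₂(W) = 4`) with `Δ > 0` the supply exists iff
  `¬ F1Sign2.DescentSignNeg W` (ε(W) = +1), and then every large silent prime works — CONSISTENCY FINDING #3 of
  `Lines/genus-supply-posdisc.md` in closed form: the `Δ > 0` row-1 cells split by `ε(W)` into «free» and «impossible».
The twin's analytic rank is NOT asserted (rank-one `2`-converse 19220, as for stub A). BSD is not proved by any of this.

References: [SerreAbelianLadic1968] I §2.2 Cor. 2; [SilvermanAEC2009] III.1, VII.3.1(b), VII.4.1(a), V.2;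
[Kramer1981] Prop. 6; [MazurRubin2010] Prop. 3.3, Prop. 5.3 (proof); [CremonaMazur2000] §3; [GrossLMS1991] §1.
-/

set_option linter.dupNamespace false -- tree convention: `Summit.BirchSwinnertonDyer.BirchSwinnertonDyer.Theorems` (summit = sub-problem)
set_option autoImplicit false

noncomputable section

open scoped Classical

open NumberField WeierstrassCurve Field IsDedekindDomain
open Literature.NumberTheory.EllipticCurves Literature.NumberTheory.GaloisRepresentations
open Summit.BirchSwinnertonDyer.BirchSwinnertonDyer.Theorems.GenusKolySign (twoTorsion_smul_eq_of_Δ_pos)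
open Summit.BirchSwinnertonDyer.Rank1Residual.F1Sign2

namespace Summit.BirchSwinnertonDyer.BirchSwinnertonDyer.Theorems.GenusKolyTwin

variable (W : WeierstrassCurve ℚ) [W.IsElliptic] [W.IsGloballyMinimal]

/-! ## §1. An element of `Γ_ℚ` with trivial cyclotomic character moving every non-zero point of `E[2]` -/

/-- Two explicit automorphisms `t` (a transposition) and `c` (a `3`-cycle) of `(ℤ/2)²` whose commutator
`t c t⁻¹ c⁻¹` moves every non-zero vector. [folklore] -/
theorem exists_addEquiv_commutator_fixedPointFree :
    ∃ t c : (Fin 2 → ZMod 2) ≃+ (Fin 2 → ZMod 2),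
      ∀ v : Fin 2 → ZMod 2, v ≠ 0 → t (c (t.symm (c.symm v))) ≠ v := by
  refine ⟨{ toFun := fun v => ![v 1, v 0], invFun := fun v => ![v 1, v 0],
            left_inv := by intro v; ext i; fin_cases i <;> rfl,
            right_inv := by intro v; ext i; fin_cases i <;> rfl,
            map_add' := by intro v w; ext i; fin_cases i <;> rfl },
          { toFun := fun v => ![v 1, v 0 + v 1], invFun := fun v => ![v 0 + v 1, v 0],
            left_inv := by decide, right_inv := by decide, map_add' := by decide }, ?_⟩
  decide

omit [W.IsGloballyMinimal] in
/-- **A commutator in `Γ_ℚ` moving every non-zero `2`-torsion point.** If `ρ̄_{E,2}` is onto, there are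
`x, y ∈ Γ_ℚ` such that `h = x y x⁻¹ y⁻¹` satisfies `h • P ≠ P` for every `P ∈ E[2] ∖ 0` (`ρ̄(x)` a transposition,
`ρ̄(y)` a `3`-cycle: the commutator is a `3`-cycle). Being a commutator, `h` lies in the kernel of every
character of `Γ_ℚ` with abelian target — in particular of every cyclotomic character. [folklore] -/
theorem exists_commutator_smul_ne_of_hasSurjectiveModNGaloisRep (hsurj : W.HasSurjectiveModNGaloisRep 2) :
    ∃ x y : absoluteGaloisGroup ℚ, ∀ P : geomTorsion W 2, P ≠ 0 → (x * y * x⁻¹ * y⁻¹) • P ≠ P := by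
  -- `E[2] ≃ (ℤ/2)²`
  have hT : ∀ P : geomTorsion W 2, 2 • P = 0 := fun P => by
    have h2 := (mem_geomTorsion_iff W 2 _).mp P.2
    apply Subtype.ext
    rw [AddSubgroupClass.coe_nsmul, ← natCast_zsmul]
    exact h2
  have hcard : Nat.card (geomTorsion W 2) = 2 ^ 2 := by
    rw [natCard_geomTorsion_two W]; norm_num
  haveI : Fact (Nat.Prime 2) := ⟨Nat.prime_two⟩
  obtain ⟨e⟩ := KolyvaginImage.nonempty_addEquiv_of_card_eq_sq hT hcard
  obtain ⟨t', c', htc⟩ := exists_addEquiv_commutator_fixedPointFree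
  set t : geomTorsion W 2 ≃+ geomTorsion W 2 := e.trans (t'.trans e.symm) with ht
  set c : geomTorsion W 2 ≃+ geomTorsion W 2 := e.trans (c'.trans e.symm) with hc
  obtain ⟨x, hx⟩ := hsurj (Multiplicative.ofAdd t)
  obtain ⟨y, hy⟩ := hsurj (Multiplicative.ofAdd c)
  have hxP : ∀ P : geomTorsion W 2, x • P = t P := fun P => by
    rw [← galoisRepTorsion_apply, hx]; rfl
  have hyP : ∀ P : geomTorsion W 2, y • P = c P := fun P => by
    rw [← galoisRepTorsion_apply, hy]; rfl
  have hxP' : ∀ P : geomTorsion W 2, x⁻¹ • P = t.symm P := fun P => by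
    rw [inv_smul_eq_iff, hxP, AddEquiv.apply_symm_apply]
  have hyP' : ∀ P : geomTorsion W 2, y⁻¹ • P = c.symm P := fun P => by
    rw [inv_smul_eq_iff, hyP, AddEquiv.apply_symm_apply]
  refine ⟨x, y, fun P hP hfix => ?_⟩
  rw [mul_smul, mul_smul, mul_smul, hyP', hxP', hyP, hxP] at hfix
  have hv : e P ≠ 0 := fun h0 => hP (by simpa using congrArg e.symm h0)
  apply htc (e P) hv
  have h1 : t (c (t.symm (c.symm P))) = e.symm (t' (c' (t'.symm (c'.symm (e P))))) := by
    simp [ht, hc, AddEquiv.trans_apply, AddEquiv.symm_trans_apply]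
  rw [h1] at hfix
  simpa using congrArg e hfix

/-! ## §2. Silent admissible primes exist (Čebotarev) -/

/-- **Silent admissible primes exist beyond every bound** (Čebotarev density theorem, PROVED in the tree). For `W/ℚ`
globally minimal elliptic with `Δ_W > 0` and `ρ̄_{W,2} : Γ_ℚ → Aut(E[2])` onto, and every `b : ℕ`, there is a prime
`ℓ > b` with `ℓ ≡ 7 (mod 8)`, `ℓ ≡ −1 (mod p)` for every odd prime `p ∣ N_W`, at which the `2`-division cubic
`4x³ + b₂x² + 2b₄x + b₆` of the minimal model has NO root mod `ℓ` (a SILENT prime: `a_ℓ` odd, `Frob_ℓ` of order `3` on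
`E[2]`). Proof in the module docstring (witness `c₀ · [x, y]`, Frobenius density, cyclotomic character of a Frobenius,
reduction of `E[2]` mod `ℓ`). [cite: SerreAbelianLadic1968, Ch. I §2.2, Cor. 2 (a)]
[cite: SilvermanAEC2009, Prop. VII.3.1(b), Prop. VII.4.1(a), V.2] -/
theorem exists_silent_prime_gt (hΔ : 0 < W.Δ) (hsurj : W.HasSurjectiveModNGaloisRep 2) (b : ℕ) :
    ∃ ℓ : ℕ, b < ℓ ∧ ℓ.Prime ∧ ℓ % 8 = 7 ∧
      (∀ p : ℕ, p.Prime → p ∣ W.conductorNorm ℤ → p ≠ 2 → (ℓ : ZMod p) = -1) ∧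
      ∀ x : ZMod ℓ, 4 * x ^ 3 + ((integralModelInt W).b₂ : ZMod ℓ) * x ^ 2 +
        2 * ((integralModelInt W).b₄ : ZMod ℓ) * x + ((integralModelInt W).b₆ : ZMod ℓ) ≠ 0 := by
  classical
  -- the modulus `m = 8 N`
  set N : ℕ := W.conductorNorm ℤ with hN
  have hN0 : N ≠ 0 := (W.conductorNorm_pos_holds).ne'
  set m : ℕ := 8 * N with hm
  have hm0 : m ≠ 0 := by positivity
  haveI : NeZero m := ⟨hm0⟩
  haveI : NeZero (m : ℚ) := ⟨by exact_mod_cast hm0⟩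
  -- the witness `γ₀ = c₀ · [x, y]`
  obtain ⟨x, y, hxy⟩ := exists_commutator_smul_ne_of_hasSurjectiveModNGaloisRep W hsurj
  obtain ⟨c₀, hc₀⟩ := exists_isComplexConjugation (Rat.castHom ℝ)
  set γ₀ : absoluteGaloisGroup ℚ := c₀ * (x * y * x⁻¹ * y⁻¹) with hγ₀
  set χ := modNCyclotomicCharacter ℚ m with hχ
  have hχγ₀ : ((χ γ₀ : (ZMod m)ˣ) : ZMod m) = -1 := by
    have h1 : χ (x * y * x⁻¹ * y⁻¹) = 1 := by
      simp only [map_mul, map_inv]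
      rw [mul_comm (χ x) (χ y)]
      group
    rw [hγ₀, map_mul, h1, mul_one]
    exact modNCyclotomicCharacter_of_isComplexConjugation hc₀
  have hγ₀P : ∀ P : geomTorsion W 2, P ≠ 0 → γ₀ • P ≠ P := fun P hP h => by
    rw [hγ₀, mul_smul, twoTorsion_smul_eq_of_Δ_pos W hΔ hc₀] at h
    exact hxy P hP h
  -- the neighbourhood `T` of `γ₀`: same action on `E[2]`, same value of `χ_m`
  set T : Set (absoluteGaloisGroup ℚ) :=
    {σ | (∀ P : geomTorsion W 2, σ • P = γ₀ • P) ∧ χ σ = χ γ₀} with hT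
  have hTnhds : T ∈ nhds γ₀ := by
    have hK : ((torsionFixing W 2 : Set (absoluteGaloisGroup ℚ)) ∩ {τ | χ τ = 1}) ∈
        nhds (1 : absoluteGaloisGroup ℚ) :=
      Filter.inter_mem ((isOpen_torsionFixing W two_ne_zero).mem_nhds (one_mem _))
        (modNCyclotomicCharacter_eventually_eq_one ℚ m)
    have hcont : Continuous fun σ : absoluteGaloisGroup ℚ => γ₀⁻¹ * σ := continuous_const_mul γ₀⁻¹
    have hK' : ((torsionFixing W 2 : Set (absoluteGaloisGroup ℚ)) ∩ {τ | χ τ = 1}) ∈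
        nhds ((fun σ : absoluteGaloisGroup ℚ => γ₀⁻¹ * σ) γ₀) := by
      simpa only [inv_mul_cancel] using hK
    refine Filter.mem_of_superset (hcont.continuousAt.preimage_mem_nhds hK') ?_
    rintro σ ⟨h1, h2⟩
    refine ⟨fun P => ?_, ?_⟩
    · have h1' := (mem_torsionFixing_iff W 2).mp h1 P
      rw [mul_smul, inv_smul_eq_iff] at h1'
      exact h1'
    · have h2' : χ (γ₀⁻¹ * σ) = 1 := h2
      rw [map_mul, map_inv, inv_mul_eq_one] at h2'
      exact h2'.symm
  -- the finite set of excluded places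
  set B : ℕ := b + m + 3 with hB
  set S : Set (HeightOneSpectrum (𝓞 ℚ)) :=
    {v | ((Rat.HeightOneSpectrum.primesEquiv v : Nat.Primes) : ℕ) < B} with hS
  have hSfin : S.Finite := by
    refine Set.Finite.preimage
      (f := fun v : HeightOneSpectrum (𝓞 ℚ) => ((Rat.HeightOneSpectrum.primesEquiv v : Nat.Primes) : ℕ))
      ?_ (Set.finite_Iio B)
    exact (Subtype.val_injective.comp Rat.HeightOneSpectrum.primesEquiv.injective).injOn
  -- Čebotarev: a Frobenius in `T` outside `S`
  obtain ⟨γ, ⟨v, hvS, 𝔓, h𝔓, hγ⟩, hγP, hγχ⟩ :=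
    (absoluteGaloisGroup.frobenius_dense Literature.NumberTheory.Automorphic.chebotarev_artinRep_holds ℚ S hSfin).inter_nhds_nonempty
      hTnhds
  -- the prime `ℓ` under `v`
  obtain ⟨ℓ, hℓ, hℓv⟩ := exists_prime_natCast_mem v
  have hvℓ : ((Rat.HeightOneSpectrum.primesEquiv v : Nat.Primes) : ℕ) = ℓ :=
    Rat.HeightOneSpectrum.primesEquiv_eq_of_natCast_mem v hℓ hℓv
  have hℓB : B ≤ ℓ := by
    have : ¬ ((Rat.HeightOneSpectrum.primesEquiv v : Nat.Primes) : ℕ) < B := hvS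
    rw [hvℓ] at this
    exact not_lt.mp this
  have hℓ2 : ℓ ≠ 2 := by omega
  haveI := Fact.mk hℓ
  -- (a) the cyclotomic conditions: `χ_m(γ) = ℓ = χ_m(γ₀) = -1`
  have hℓm : ¬ ℓ ∣ m := fun h => by
    have := Nat.le_of_dvd (Nat.pos_of_ne_zero hm0) h
    omega
  have hχγ : ((χ γ : (ZMod m)ˣ) : ZMod m) = (ℓ : ZMod m) := by
    rw [← hvℓ]
    exact Summit.BirchSwinnertonDyer.Rank1Residual.GaloisImage.CyclotomicLevel.Rat.modNCyclotomicCharacter_of_isArithFrobAtPlace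
      (by rw [hvℓ]; exact hℓm) ⟨𝔓, h𝔓, hγ⟩
  have hℓmod : (ℓ : ZMod m) = -1 := by rw [← hχγ, hγχ, hχγ₀]
  have hℓ8 : ℓ % 8 = 7 := by
    have h8 : (ℓ : ZMod 8) = -1 := by
      have := congrArg (ZMod.castHom (show 8 ∣ m from ⟨N, rfl⟩) (ZMod 8)) hℓmod
      rwa [map_natCast, map_neg, map_one] at this
    have h8' : (ℓ : ZMod 8) = ((7 : ℕ) : ZMod 8) := by rw [h8]; decide
    exact (ZMod.natCast_eq_natCast_iff' ℓ 7 8).mp h8'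
  have hℓN : ∀ p : ℕ, p.Prime → p ∣ W.conductorNorm ℤ → p ≠ 2 → (ℓ : ZMod p) = -1 := by
    intro p _ hpN _
    have hpm : p ∣ m := Dvd.dvd.mul_left hpN 8
    have := congrArg (ZMod.castHom hpm (ZMod p)) hℓmod
    rwa [map_natCast, map_neg, map_one] at this
  refine ⟨ℓ, by omega, hℓ, hℓ8, hℓN, ?_⟩
  -- (b) the silent condition: `γ` moves every non-zero `2`-torsion point, hence `Ẽ(𝔽_ℓ)[2] = 0`
  obtain ⟨hℓN', hℓΔ, -⟩ := exists_heegnerField_of_prime W hℓ hℓ8 hℓN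
  have hgoodℓ : W.HasGoodReductionAtPrime ℓ := hasGoodReductionAtPrime_of_not_dvd W ℓ hℓΔ
  obtain ⟨σ₀, 𝔓₀, h𝔓₀, hσ₀, hcount⟩ :=
    Summit.BirchSwinnertonDyer.Rank1Residual.GaloisImage.FrobShape.exists_frobenius_natCard_fixed_eq
      W 2 ℓ hℓ2 hgoodℓ hℓv
  obtain ⟨g, hg⟩ := HeightOneSpectrum.exists_smul_eq_of_mem_primesAbove_holds h𝔓₀ h𝔓
  have hσ₁ : IsArithFrobAt (𝓞 ℚ) (g * σ₀ * g⁻¹) 𝔓 := hg ▸ hσ₀.conj g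
  have hI := hγ.mul_inv_mem_inertia hσ₁
  have hgood : W.HasGoodReductionAt v := (hasGoodReductionAtPrime_primesEquiv_iff_holds W v ℓ hvℓ).mp hgoodℓ
  have h2v : (2 : 𝓞 ℚ) ∉ v.asIdeal := fun h2 =>
    hℓ2 (hvℓ.symm.trans (Rat.HeightOneSpectrum.primesEquiv_eq_of_natCast_mem v Nat.prime_two (by exact_mod_cast h2)))
  have h2v' : ((((2 : ℕ) : ℤ)) : 𝓞 ℚ) ∉ v.asIdeal := by
    rw [Int.cast_natCast]; exact_mod_cast h2v
  have hσσ₁ : ∀ P : geomTorsion W ((2 : ℕ) : ℤ), γ • P = (g * σ₀ * g⁻¹) • P := fun P => by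
    have h' := W.smul_geomTorsion_eq_of_mem_inertia hgood h2v' h𝔓 hI ((g * σ₀ * g⁻¹) • P)
    rwa [mul_smul, inv_smul_smul] at h'
  -- `σ₀` fixes only `0` on `E[2]`
  have hall : ∀ P : geomTorsion W ((2 : ℕ) : ℤ), σ₀ • P = P → P = 0 := fun P hfix => by
    by_contra hP
    have h' : (g * σ₀ * g⁻¹) • (g • P) = g • P := by
      rw [mul_smul, mul_smul, inv_smul_smul, hfix]
    rw [← hσσ₁, hγP] at h'
    exact hγ₀P (g • P) (fun h0 => hP (by simpa using congrArg (fun Q => g⁻¹ • Q) h0)) h'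
  have hc1 := hcount 1
  rw [pow_one] at hc1
  have hfix1 : Nat.card {P : geomTorsion W ((2 : ℕ) : ℤ) // σ₀ • P = P} = 1 := by
    rw [Nat.card_eq_one_iff_unique]
    exact ⟨⟨fun a b => Subtype.ext ((hall a.1 a.2).trans (hall b.1 b.2).symm)⟩, ⟨⟨0, smul_zero σ₀⟩⟩⟩
  rw [hfix1] at hc1
  -- hence `#Ẽ_v(k_v)` is odd, i.e. `a_ℓ` is odd, i.e. `ℓ` is silent
  have hc : Nat.card (W.reductionAt v).toAffine.Point = reductionPointCount W ℓ := by
    rw [← hvℓ]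
    exact natCard_point_reduction_minimal_baseChange v W
  haveI : Finite (W.reductionAt v).toAffine.Point := by
    refine Nat.finite_of_card_ne_zero ?_
    rw [hc, reductionPointCount]
    haveI : NeZero ℓ := ⟨hℓ.ne_zero⟩
    exact Nat.card_pos.ne'
  have hodd : Odd (Nat.card (W.reductionAt v).toAffine.Point) := by
    refine (forall_two_nsmul_eq_zero_iff_odd_natCard (A := (W.reductionAt v).toAffine.Point)).mp fun Q hQ => ?_
    have hmem : Q ∈ AddSubgroup.torsionBy (W.reductionAt v).toAffine.Point ((2 : ℕ) : ℤ) := by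
      rw [Submodule.mem_toAddSubgroup, Submodule.mem_torsionBy_iff, Nat.cast_ofNat, two_zsmul, ← two_nsmul]
      exact hQ
    haveI := (Nat.card_eq_one_iff_unique.mp hc1.symm).1
    have h0 : (⟨Q, hmem⟩ : AddSubgroup.torsionBy (W.reductionAt v).toAffine.Point ((2 : ℕ) : ℤ)) =
        ⟨0, AddSubgroup.zero_mem _⟩ := Subsingleton.elim _ _
    exact congrArg Subtype.val h0
  rw [hc] at hodd
  have hoddTr : Odd (W.frobeniusTrace ℓ) := by
    have h1 : Even ((ℓ : ℤ) + 1) := by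
      obtain ⟨k, hk⟩ := hℓ.odd_of_ne_two hℓ2
      exact ⟨k + 1, by push_cast [hk]; ring⟩
    rw [WeierstrassCurve.frobeniusTrace, Int.odd_sub']
    exact iff_of_true (by exact_mod_cast hodd) h1
  exact (silent_iff_odd_frobeniusTrace W hℓ2 hℓΔ).mpr hoddTr

/-! ## §3. Consequences: the `Δ > 0` DEF = 1 supply with the Heegner field free beyond any bound -/

/-- **Silent prime Heegner fields exist beyond every bound** (UNCONDITIONAL): for `W/ℚ` globally minimal elliptic with
`Δ_W > 0` and `ρ̄_{W,2}` onto, and every `b`, there is a prime `ℓ > b`, `ℓ ≡ 7 (mod 8)`, `ℓ ≡ −1 (mod p)` for every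
odd `p ∣ N_W`, SILENT for `W` (no root of the `2`-division cubic mod `ℓ`), hence `F1Sign2.DescAdmissible W (−ℓ)`,
`E(ℚ_ℓ)[2] = 0`, and `K = ℚ(√−ℓ)` carries every K-clause of crux 22136 with `2` split — a DEF(W,K) = 1 admissible
Heegner field on `Δ > 0`. [cite: SerreAbelianLadic1968, Ch. I §2.2, Cor. 2 (a)] [cite: GrossLMS1991, §1 (p. 235)] -/
theorem exists_silent_prime_heegnerField (hΔ : 0 < W.Δ) (hsurj : W.HasSurjectiveModNGaloisRep 2) (b : ℕ) :
    ∃ ℓ : ℕ, b < ℓ ∧ ℓ.Prime ∧ ℓ % 8 = 7 ∧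
      (∀ p : ℕ, p.Prime → p ∣ W.conductorNorm ℤ → p ≠ 2 → (ℓ : ZMod p) = -1) ∧
      (∀ x : ZMod ℓ, 4 * x ^ 3 + ((integralModelInt W).b₂ : ZMod ℓ) * x ^ 2 +
        2 * ((integralModelInt W).b₄ : ZMod ℓ) * x + ((integralModelInt W).b₆ : ZMod ℓ) ≠ 0) ∧
      DescAdmissible W (-(ℓ : ℤ)) ∧
      (∀ [Fact ℓ.Prime], ∀ Q : (W.baseChange ℚ_[ℓ]).toAffine.Point, 2 • Q = 0 → Q = 0) ∧
      ∃ (K : Type) (_ : Field K) (_ : NumberField K), IsImaginaryQuadratic K ∧ discr K = -(ℓ : ℤ) ∧ Odd (discr K) ∧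
        discr K ≠ -3 ∧ SatisfiesHeegnerHypothesis (W.conductorNorm ℤ) K ∧
        ((Ideal.span {(2 : ℤ)}).primesOver (𝓞 K)).ncard = 2 ∧
        ¬ IsSquare ((discr K : ℚ) * -|W.Δ|) ∧ ¬ IsSquare ((discr K : ℚ) * (-(2 * |W.Δ|))) := by
  obtain ⟨ℓ, hb, hℓ, hℓ8, hℓN, hsil⟩ := exists_silent_prime_gt W hΔ hsurj b
  exact ⟨ℓ, hb, hℓ, hℓ8, hℓN, hsil, exists_silent_heegnerField_of_prime W hℓ hℓ8 hℓN hsil⟩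

/-- **SUPPLY″ on `{Δ_W > 0, #Sel₂(W) = 1}` with `K` free beyond any bound** (modulo T-A
`F1Sign2.AdmissibleTwistSelmerShiftAtTwo` BY NAME only; the Čebotarev input is PROVED): `W/ℚ` globally minimal elliptic,
`Δ_W > 0`, `ρ̄_{W,2}` onto, `#Sel₂(W) = 1`; then beyond every bound there are a silent admissible prime `ℓ`, the DEF = 1
Heegner field `K = ℚ(√−ℓ)` with every K-clause of crux 22136 and `2` split, `E(ℚ_ℓ)[2] = 0`, and a GLOBALLY MINIMAL twin
`Wd ≅ W^{(−ℓ)}` with `#Sel₂(Wd) = 2`. The `Δ > 0` companion of g6's `exists_prime_heegnerField_minimalTwin_of_prop33`.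
[cite: Kramer1981, Prop. 6] [cite: MazurRubin2010, Prop. 3.3] -/
theorem supply_DEF1_posDisc (hA : AdmissibleTwistSelmerShiftAtTwo) (hΔ : 0 < W.Δ)
    (hsurj : W.HasSurjectiveModNGaloisRep 2) (h1 : Nat.card (W.selmerGroup 2) = 1) (b : ℕ) :
    ∃ ℓ : ℕ, b < ℓ ∧ ℓ.Prime ∧
      (∀ x : ZMod ℓ, 4 * x ^ 3 + ((integralModelInt W).b₂ : ZMod ℓ) * x ^ 2 +
        2 * ((integralModelInt W).b₄ : ZMod ℓ) * x + ((integralModelInt W).b₆ : ZMod ℓ) ≠ 0) ∧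
      ∃ (K : Type) (_ : Field K) (_ : NumberField K), IsImaginaryQuadratic K ∧ discr K = -(ℓ : ℤ) ∧ Odd (discr K) ∧
        discr K ≠ -3 ∧ SatisfiesHeegnerHypothesis (W.conductorNorm ℤ) K ∧
        ¬ IsSquare ((discr K : ℚ) * -|W.Δ|) ∧ ¬ IsSquare ((discr K : ℚ) * (-(2 * |W.Δ|))) ∧
        ((Ideal.span {(2 : ℤ)}).primesOver (𝓞 K)).ncard = 2 ∧
        (∀ [Fact ℓ.Prime], ∀ Q : (W.baseChange ℚ_[ℓ]).toAffine.Point, 2 • Q = 0 → Q = 0) ∧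
        ∃ (Wd : WeierstrassCurve ℚ) (_ : Wd.IsElliptic) (_ : Wd.IsGloballyMinimal),
          (∃ C : VariableChange ℚ, C • W.quadraticTwist (discr K : ℚ) = Wd) ∧ Nat.card (Wd.selmerGroup 2) = 2 := by
  obtain ⟨ℓ, hb, hℓ, hℓ8, hℓN, hsil⟩ := exists_silent_prime_gt W hΔ hsurj b
  exact ⟨ℓ, hb, hℓ, hsil, supply_DEF1_posDisc_of_shift W hA hΔ
    (noRationalTwoTorsion_of_hasSurjectiveModNGaloisRep W (by simpa using hsurj)) h1 hℓ hℓ8 hℓN hsil⟩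

/-- **ROW 1 on `Δ > 0`, ε = +1: the DEF = 1 Sel₂-minimal twin is supplied by EVERY large silent prime** (mod T-V BY NAME;
Čebotarev PROVED): `Δ_W > 0`, `ρ̄_{W,2}` onto, rank `0`, `#Sel₂(W) = 4`, and NOT `F1Sign2.DescentSignNeg W` ⟹ beyond every
bound a silent admissible prime `ℓ` with the DEF = 1 field `ℚ(√−ℓ)` (every K-clause of crux 22136, `2` split,
`E(ℚ_ℓ)[2] = 0`) and a globally minimal twin with `#Sel₂ = 2`. Together with `no_minimalTwin_of_descentSignNeg` (ε = −1: NO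
DEF = 1 field works) this settles the `Δ > 0` row-1 supply by the sign `ε(W)` alone.
[cite: Kramer1981, Prop. 6] [cite: CremonaMazur2000, §3] -/
theorem supply_DEF1_posDisc_rowOne_of_not_descentSignNeg (hV : StrictShaPropagationAtTwo) (hΔ : 0 < W.Δ)
    (hsurj : W.HasSurjectiveModNGaloisRep 2) (hr : W.mordellWeilRank = 0) (h4 : Nat.card (W.selmerGroup 2) = 4)
    (hε : ¬ DescentSignNeg W) (b : ℕ) :
    ∃ ℓ : ℕ, b < ℓ ∧ ℓ.Prime ∧
      (∀ x : ZMod ℓ, 4 * x ^ 3 + ((integralModelInt W).b₂ : ZMod ℓ) * x ^ 2 +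
        2 * ((integralModelInt W).b₄ : ZMod ℓ) * x + ((integralModelInt W).b₆ : ZMod ℓ) ≠ 0) ∧
      ∃ (K : Type) (_ : Field K) (_ : NumberField K), IsImaginaryQuadratic K ∧ discr K = -(ℓ : ℤ) ∧ Odd (discr K) ∧
        discr K ≠ -3 ∧ SatisfiesHeegnerHypothesis (W.conductorNorm ℤ) K ∧
        ¬ IsSquare ((discr K : ℚ) * -|W.Δ|) ∧ ¬ IsSquare ((discr K : ℚ) * (-(2 * |W.Δ|))) ∧
        ((Ideal.span {(2 : ℤ)}).primesOver (𝓞 K)).ncard = 2 ∧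
        (∀ [Fact ℓ.Prime], ∀ Q : (W.baseChange ℚ_[ℓ]).toAffine.Point, 2 • Q = 0 → Q = 0) ∧
        ∃ (Wd : WeierstrassCurve ℚ) (_ : Wd.IsElliptic) (_ : Wd.IsGloballyMinimal),
          (∃ C : VariableChange ℚ, C • W.quadraticTwist (discr K : ℚ) = Wd) ∧ Nat.card (Wd.selmerGroup 2) = 2 := by
  have ht := noRationalTwoTorsion_of_hasSurjectiveModNGaloisRep W (by simpa using hsurj)
  obtain ⟨ℓ, hb, hℓ, hℓ8, hℓN, hsil⟩ := exists_silent_prime_gt W hΔ hsurj b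
  rcases supply_DEF1_posDisc_rowOne_dichotomy W hV hΔ ht hr h4 with hall | hall
  · exact ⟨ℓ, hb, hℓ, hsil, hall hℓ hℓ8 hℓN hsil⟩
  · exfalso
    apply hε
    have hDA := descAdmissible_neg_prime_of_silent W hℓ hℓ8 hℓN hsil
    refine ⟨-(ℓ : ℤ), hDA, ?_⟩
    have hd0 : ((-(ℓ : ℤ) : ℤ) : ℚ) ≠ 0 := by exact_mod_cast neg_ne_zero.mpr (Int.natCast_ne_zero.mpr hℓ.ne_zero)
    haveI := W.isElliptic_quadraticTwist hd0
    have h8 := hall (-(ℓ : ℤ)) hDA (W.quadraticTwist ((-(ℓ : ℤ) : ℤ) : ℚ)) ⟨1, one_smul _ _⟩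
    rw [selmerTwoCard, h4, twistSelmerTwoCard, h8]

/-- **Row 1 on `Δ > 0` is decided by the descent sign** (mod T-V BY NAME; Čebotarev PROVED): under `Δ_W > 0`, `ρ̄_{W,2}`
onto, rank `0`, `#Sel₂(W) = 4`, EITHER `F1Sign2.DescentSignNeg W` (and then no DEF = 1 Heegner field has a Sel₂-minimal twin,
`no_minimalTwin_of_descentSignNeg`) OR every `-desc`-admissible twist — in particular the twin at every DEF = 1 Heegner field
with `2` split (`descAdmissible_discr_of_forall_silent`) — has `#Sel₂ = 2`. [cite: Kramer1981, Prop. 6] [cite: CremonaMazur2000, §3] -/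
theorem descentSignNeg_or_forall_minimalTwin (hV : StrictShaPropagationAtTwo) (hΔ : 0 < W.Δ)
    (hsurj : W.HasSurjectiveModNGaloisRep 2) (hr : W.mordellWeilRank = 0) (h4 : Nat.card (W.selmerGroup 2) = 4) :
    DescentSignNeg W ∨
      ∀ d : ℤ, DescAdmissible W d → ∀ (Wd : WeierstrassCurve ℚ) [Wd.IsElliptic],
        (∃ C : VariableChange ℚ, C • W.quadraticTwist (d : ℚ) = Wd) → Nat.card (Wd.selmerGroup 2) = 2 := by
  have ht := noRationalTwoTorsion_of_hasSurjectiveModNGaloisRep W (by simpa using hsurj)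
  rcases hV W hΔ ht hr (by rw [selmerTwoCard, h4]) with hall | hall
  · right
    intro d hd Wd _ hWd
    rw [natCard_selmerGroup_model_eq_twistSelmerTwoCard W hd.1.ne Wd hWd, hall d hd]
  · left
    obtain ⟨ℓ, -, hℓ, hℓ8, hℓN, hsil⟩ := exists_silent_prime_gt W hΔ hsurj 0
    refine ⟨-(ℓ : ℤ), descAdmissible_neg_prime_of_silent W hℓ hℓ8 hℓN hsil, ?_⟩
    rw [hall _ (descAdmissible_neg_prime_of_silent W hℓ hℓ8 hℓN hsil), selmerTwoCard, h4]

end Summit.BirchSwinnertonDyer.BirchSwinnertonDyer.Theorems.GenusKolyTwin
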